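import Summits.FinalStateConjecture.FinalStateConjecture.Theorems.SwallowTheDatumUniversalWitnessFamilyStubClusterFarField
import Mathlib.Analysis.Calculus.MeanValue
import Mathlib.Analysis.InnerProductSpace.Calculus
import Literature.Geometry.Lorentzian.ObstructionFreeGluing
import HarnessLib

/-!
# `ParametricKerrBurial`, line `receding-annulus-universal-collar` — stub `stub_bulkCoulombSource` (BK3c):
# the source-shift Taylor bound for finite Coulomb sums

Support file (everything proved, no definitions) for the stub `stub_bulkCoulombSource` of crux
`stmt-FinalStateConjecture-10052` (`Summit.FinalStateConjecture.FinalStateConjecture.Theses.SwallowTheDatum.ParametricKerrBurial`).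

Far from a cluster of unit point sources at `q_i` with `‖q_i‖ ≤ ℓ ≤ ‖z‖/4`, the Brill–Lindquist potential
`Σ_i ‖z − q_i‖⁻¹` differs from the potential `#S · ‖z‖⁻¹` of the same total charge placed at the origin by

  `F(z) = Σ_{i ∈ S} (‖z − q_i‖⁻¹ − ‖z‖⁻¹)`,

and `F` is small in `C²` there: `‖Dᵐ F(z)‖ ≤ C · #S · ℓ / ‖z‖ᵐ⁺²` for `m ≤ 2`, GIVEN the universal Newton-kernel
bounds `‖Dᵐ(‖·‖⁻¹)(u)‖ ≤ C₀/‖u‖ᵐ⁺¹` (`m ≤ 3`, `u ≠ 0`) as a hypothesis (they are conjunct (i) of the sibling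
stub `stub_bulkCoulomb`; `C = 4 C₀`).  Proof: translation invariance `Dᵐ(‖· − q‖⁻¹)(z) = Φ_m(z − q)`,
`Φ_m := Dᵐ(‖·‖⁻¹)`, and the mean value inequality for the `C¹` map `Φ_m` on the closed ball `B̄(z, ‖z‖/4)`,
every point `u` of which has `‖u‖ ≥ 3‖z‖/4`, whence `‖DΦ_m(u)‖ = ‖Dᵐ⁺¹(‖·‖⁻¹)(u)‖ ≤ C₀/‖u‖ᵐ⁺² ≤ 4 C₀/‖z‖ᵐ⁺²`
(`(4/3)ᵐ⁺² ≤ 4` for `m ≤ 2`); the derivative of the finite sum is the sum of the derivatives of its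
summands, each `C^∞` near `z` (`z ≠ 0`, `z ≠ q_i`).  The smoothness of the (shifted) Newton kernel off its
pole, the differentiability of its iterated derivatives and translation invariance are REUSED from the landed
sibling toolkit `…SwallowTheDatumUniversalWitnessFamilyStubClusterFarField` (`contDiffAt_invNorm`,
`contDiffAt_invNorm_sub`, `differentiableAt_iteratedFDeriv_invNorm`, `iteratedFDeriv_invNorm_sub`).

* `BulkCoulombSource.norm_iteratedFDeriv_invNorm_shift_sub_le` — the one-source mean value estimate;
* `BulkCoulombSource.iteratedFDeriv_sum_shift_sub` — the derivatives of the finite sum, summand-wise;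
* `stub_bulkCoulombSource` — the registered stub.

References: D. R. Brill, R. W. Lindquist, Phys. Rev. 131 (1963) 471–476, §II (the `N`-body time-symmetric
datum); O. D. Kellogg, *Foundations of Potential Theory* (1929), Ch. V (derivatives of Newtonian potentials,
expansion at a distance).  Mathlib: `iteratedFDeriv_comp_sub`, `iteratedFDeriv_fun_sum_apply`,
`Convex.norm_image_sub_le_of_norm_fderiv_le`, `norm_fderiv_iteratedFDeriv`, `contDiffAt_norm`.
-/

-- the doubled `FinalStateConjecture` path component is the summit/problem naming scheme, not a mistake
set_option linter.dupNamespace false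
-- instance search through the nested operator types of `iteratedFDeriv`s (`E3 [×m]→L[ℝ] ℝ`)
set_option maxSynthPendingDepth 3

noncomputable section

namespace Summit.FinalStateConjecture.FinalStateConjecture.Theorems.SwallowTheDatum.ParametricKerrBurial

open scoped Manifold ContDiff Topology BigOperators InnerProductSpace
open Bundle Set Filter Function MeasureTheory Literature.Geometry.Lorentzian
open Literature.Geometry.Lorentzian.MaoOhTao Literature.Geometry.Lorentzian.InitialDataSet
open Summit.FinalStateConjecture.FinalStateConjecture.Theorems.SwallowTheDatum.UniversalWitnessFamily
  (contDiffAt_invNorm contDiffAt_invNorm_sub differentiableAt_iteratedFDeriv_invNorm iteratedFDeriv_invNorm_sub)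

namespace BulkCoulombSource

/-! ## §1 The one-source mean value estimate -/

/-- Every point of the closed ball `B̄(z, ‖z‖/4)` has norm `≥ 3‖z‖/4`. [folklore] -/
theorem norm_ge_of_mem_closedBall {z u : E3} (hu : u ∈ Metric.closedBall z (‖z‖ / 4)) :
    3 / 4 * ‖z‖ ≤ ‖u‖ := by
  rw [Metric.mem_closedBall, dist_eq_norm, norm_sub_rev] at hu
  linarith [norm_sub_norm_le z u]

/-- For `k ≤ 4` and `3‖z‖/4 ≤ ‖u‖`: `‖z‖ᵏ ≤ 4‖u‖ᵏ` (as `(4/3)⁴ = 256/81 ≤ 4`). [folklore] -/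
theorem pow_norm_le_four_mul_pow_norm {z u : E3} {k : ℕ} (hk : k ≤ 4) (hu : 3 / 4 * ‖z‖ ≤ ‖u‖) :
    ‖z‖ ^ k ≤ 4 * ‖u‖ ^ k := by
  have h34 : (3 / 4 * ‖z‖) ^ k ≤ ‖u‖ ^ k := pow_le_pow_left₀ (by positivity) hu k
  have hc : (1 : ℝ) ≤ 4 * (3 / 4 : ℝ) ^ k := by
    interval_cases k <;> norm_num
  calc ‖z‖ ^ k ≤ 4 * (3 / 4 : ℝ) ^ k * ‖z‖ ^ k := le_mul_of_one_le_left (by positivity) hc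
    _ = 4 * (3 / 4 * ‖z‖) ^ k := by rw [mul_pow, mul_assoc]
    _ ≤ 4 * ‖u‖ ^ k := by linarith

/-- **One shifted source, one order.** If `‖Dᵏ(‖·‖⁻¹)(u)‖ ≤ C₀/‖u‖ᵏ⁺¹` for `k ≤ 3` and `u ≠ 0`, then for
`m ≤ 2`, `0 < ‖z‖` and `4‖q‖ ≤ ‖z‖`, the mean value inequality for `Φ_m = Dᵐ(‖·‖⁻¹)` on the closed ball
`B̄(z, ‖z‖/4)` (which contains `z` and `z − q` and stays at distance `≥ 3‖z‖/4` from the pole, so that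
`‖DΦ_m‖ = ‖Dᵐ⁺¹(‖·‖⁻¹)‖ ≤ 4C₀/‖z‖ᵐ⁺²` on it) gives `‖Φ_m(z − q) − Φ_m(z)‖ ≤ (4C₀/‖z‖ᵐ⁺²) ‖q‖`. [folklore] -/
theorem norm_iteratedFDeriv_invNorm_shift_sub_le {C₀ : ℝ} (hC₀ : 0 < C₀)
    (hN : ∀ u : E3, u ≠ 0 → ∀ m : ℕ, m ≤ 3 →
      ‖iteratedFDeriv ℝ m (fun v : E3 ↦ ‖v‖⁻¹) u‖ ≤ C₀ / ‖u‖ ^ (m + 1))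
    {m : ℕ} (hm : m ≤ 2) {z q : E3} (hz : 0 < ‖z‖) (hq : 4 * ‖q‖ ≤ ‖z‖) :
    ‖iteratedFDeriv ℝ m (fun v : E3 ↦ ‖v‖⁻¹) (z - q) - iteratedFDeriv ℝ m (fun v : E3 ↦ ‖v‖⁻¹) z‖ ≤
      4 * C₀ / ‖z‖ ^ (m + 2) * ‖q‖ := by
  have hs0 : ∀ u ∈ Metric.closedBall z (‖z‖ / 4), u ≠ 0 := fun u hu h ↦ by
    have := norm_ge_of_mem_closedBall hu
    rw [h, norm_zero] at this
    linarith
  -- `Φ_m` is differentiable on the ball, with `‖DΦ_m‖ ≤ 4 C₀/‖z‖ᵐ⁺²`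
  have hdiff : ∀ u ∈ Metric.closedBall z (‖z‖ / 4),
      DifferentiableAt ℝ (iteratedFDeriv ℝ m (fun v : E3 ↦ ‖v‖⁻¹)) u := fun u hu ↦
    differentiableAt_iteratedFDeriv_invNorm m (hs0 u hu)
  have hbound : ∀ u ∈ Metric.closedBall z (‖z‖ / 4),
      ‖fderiv ℝ (iteratedFDeriv ℝ m (fun v : E3 ↦ ‖v‖⁻¹)) u‖ ≤ 4 * C₀ / ‖z‖ ^ (m + 2) := fun u hu ↦ by
    rw [norm_fderiv_iteratedFDeriv]
    have hu := norm_ge_of_mem_closedBall hu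
    have hu0 : 0 < ‖u‖ := by linarith
    have hpow : ‖z‖ ^ (m + 2) ≤ 4 * ‖u‖ ^ (m + 2) := pow_norm_le_four_mul_pow_norm (by omega) hu
    calc ‖iteratedFDeriv ℝ (m + 1) (fun v : E3 ↦ ‖v‖⁻¹) u‖ ≤ C₀ / ‖u‖ ^ (m + 1 + 1) :=
          hN u (hs0 u ‹_›) (m + 1) (by omega)
      _ = C₀ / ‖u‖ ^ (m + 2) := rfl
      _ ≤ C₀ / (‖z‖ ^ (m + 2) / 4) :=
          div_le_div_of_nonneg_left hC₀.le (by positivity) (by linarith)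
      _ = 4 * C₀ / ‖z‖ ^ (m + 2) := by
          field_simp
  -- the mean value inequality on the (convex) ball between `z` and `z - q`
  have hzs : z ∈ Metric.closedBall z (‖z‖ / 4) := Metric.mem_closedBall_self (by positivity)
  have hqs : z - q ∈ Metric.closedBall z (‖z‖ / 4) := by
    rw [Metric.mem_closedBall, dist_eq_norm, sub_sub_cancel_left, norm_neg]
    linarith
  have key := (convex_closedBall z (‖z‖ / 4)).norm_image_sub_le_of_norm_fderiv_le hdiff hbound hzs hqs
  rwa [sub_sub_cancel_left, norm_neg] at key

/-! ## §2 The finite sum -/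

/-- **Derivatives of the finite sum, summand-wise.** At `z ≠ 0` with all `z − q_i ≠ 0` (`i ∈ S`),
`Dᵐ(Σ_{i ∈ S} (‖· − q_i‖⁻¹ − ‖·‖⁻¹))(z) = Σ_{i ∈ S} (Φ_m(z − q_i) − Φ_m(z))` with `Φ_m = Dᵐ(‖·‖⁻¹)`:
additivity of `Dᵐ` over functions smooth near `z`, and translation invariance of `Dᵐ`. [folklore] -/
theorem iteratedFDeriv_sum_shift_sub (S : Finset ℕ) (q : ℕ → E3) {z : E3} (hz : z ≠ 0)
    (hq : ∀ i ∈ S, z - q i ≠ 0) (m : ℕ) :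
    iteratedFDeriv ℝ m (fun w : E3 ↦ ∑ i ∈ S, (‖w - q i‖⁻¹ - ‖w‖⁻¹)) z =
      ∑ i ∈ S, (iteratedFDeriv ℝ m (fun v : E3 ↦ ‖v‖⁻¹) (z - q i) -
        iteratedFDeriv ℝ m (fun v : E3 ↦ ‖v‖⁻¹) z) := by
  rw [iteratedFDeriv_fun_sum_apply fun i hi ↦
    (contDiffAt_invNorm_sub (hq i hi)).sub (contDiffAt_invNorm hz)]
  refine Finset.sum_congr rfl fun i hi ↦ ?_
  rw [fun_iteratedFDeriv_sub_apply (contDiffAt_invNorm_sub (hq i hi)) (contDiffAt_invNorm hz),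
    iteratedFDeriv_invNorm_sub]

end BulkCoulombSource

open BulkCoulombSource in
/-- **STUB BK3c `stub_bulkCoulombSource`** (the source-shift Taylor bound, from the Newton-kernel bounds):
moving finitely many unit sources from the origin to points `q_i` with `‖q_i‖ ≤ ℓ ≤ ‖z‖/4` changes the
potential at `z`, together with its first two derivatives, by at most `C · #S · ℓ/‖z‖ᵐ⁺²` (`C = 4C₀` for
the Newton-kernel constant `C₀` of the hypothesis), and the shifted sum is `C^∞` at `z`.  Brill–Lindquist
1963, §II; Kellogg 1929, Ch. V. [folklore] -/
theorem stub_bulkCoulombSource :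
    (∃ C : ℝ, 0 < C ∧ ∀ u : E3, u ≠ 0 → ∀ m : ℕ, m ≤ 3 →
      ‖iteratedFDeriv ℝ m (fun v : E3 ↦ ‖v‖⁻¹) u‖ ≤ C / ‖u‖ ^ (m + 1)) →
    ∃ C : ℝ, 0 < C ∧ ∀ (S : Finset ℕ) (q : ℕ → E3) (ℓ : ℝ) (z : E3), 0 ≤ ℓ → (∀ i ∈ S, ‖q i‖ ≤ ℓ) →
      0 < ‖z‖ → 4 * ℓ ≤ ‖z‖ →
      (∀ m : ℕ, m ≤ 2 →
        ‖iteratedFDeriv ℝ m (fun z : E3 ↦ ∑ i ∈ S, (‖z - q i‖⁻¹ - ‖z‖⁻¹)) z‖ ≤ C * S.card * ℓ / ‖z‖ ^ (m + 2)) ∧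
      ContDiffAt ℝ ∞ (fun z : E3 ↦ ∑ i ∈ S, (‖z - q i‖⁻¹ - ‖z‖⁻¹)) z := by
  rintro ⟨C₀, hC₀, hN⟩
  refine ⟨4 * C₀, by positivity, fun S q ℓ z _ hq hz hℓz ↦ ?_⟩
  have hz0 : z ≠ 0 := norm_pos_iff.1 hz
  have hqz : ∀ i ∈ S, 4 * ‖q i‖ ≤ ‖z‖ := fun i hi ↦ by linarith [hq i hi]
  have hne : ∀ i ∈ S, z - q i ≠ 0 := fun i hi h ↦ by
    have : ‖q i‖ = ‖z‖ := by rw [sub_eq_zero.1 h]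
    linarith [hqz i hi]
  refine ⟨fun m hm ↦ ?_,
    ContDiffAt.sum fun i hi ↦ (contDiffAt_invNorm_sub (hne i hi)).sub (contDiffAt_invNorm hz0)⟩
  rw [iteratedFDeriv_sum_shift_sub S q hz0 hne m]
  calc ‖∑ i ∈ S, (iteratedFDeriv ℝ m (fun v : E3 ↦ ‖v‖⁻¹) (z - q i) -
          iteratedFDeriv ℝ m (fun v : E3 ↦ ‖v‖⁻¹) z)‖
      ≤ ∑ i ∈ S, ‖iteratedFDeriv ℝ m (fun v : E3 ↦ ‖v‖⁻¹) (z - q i) -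
          iteratedFDeriv ℝ m (fun v : E3 ↦ ‖v‖⁻¹) z‖ := norm_sum_le _ _
    _ ≤ ∑ i ∈ S, 4 * C₀ / ‖z‖ ^ (m + 2) * ℓ := Finset.sum_le_sum fun i hi ↦
        (norm_iteratedFDeriv_invNorm_shift_sub_le hC₀ hN hm hz (hqz i hi)).trans
          (mul_le_mul_of_nonneg_left (hq i hi) (by positivity))
    _ = 4 * C₀ * S.card * ℓ / ‖z‖ ^ (m + 2) := by
        rw [Finset.sum_const, nsmul_eq_mul]
        ring

end Summit.FinalStateConjecture.FinalStateConjecture.Theorems.SwallowTheDatum.ParametricKerrBurial
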